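import Summits.ValiantsHypothesis.ValiantsHypothesis.Theorems.BarrierLeverAnchoredDoorHitsLowerPairsStarVertexRichSplit
import Summits.ValiantsHypothesis.ValiantsHypothesis.Theorems.BarrierLeverPartitionMinorsHitByVPNearPrincipalLayouts

/-!
# Route BarrierLever — support item `AnchoredDoorHitsLowerPairs` (stmt-ValiantsHypothesis-22510), line `anchored_peeling`:
# EVERY VERTEX-RICH LOWER PAIR IS STAR-GOOD

Helper file (`--supports stmt-ValiantsHypothesis-22510`; val-np-p1 g34). Door slot of record `Stmt.conjStarLower` (…StarDoor):
this file proves it on the class of VERTEX-RICH pairs. Closes NO item; nothing here bears on crux 14610 or on `VP ≠ VNP`,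
which is NOT proved; `Stmt.conjStarLower` itself is NOT proved here.

**THEOREM (`starDet_ne_zero_of_vertexRich`).** Let `u, w : Fin r → Finset (Fin h)` be injective enumerations of LOWER families
with `n₁` resp. `n₂` faces of size one (vertices). If `r ≤ n₁ + n₂ + 1` — equivalently: the row faces of size `≥ 2` are at most as
many as the column vertices (and then symmetrically) — then some complex edge weights `g, d` make the star-forest block
`(starEntry g d (u i) (w j))_{i j}` nonsingular. Door / item level: `symbolicDet 2 ≠ 0` and `AnchoredHit 2` on every such pair
(`symbolicDet_two_ne_zero_of_vertexRich`, `anchoredHit_two_of_vertexRich`).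

SCOPE. Every pair of 1-dimensional complexes (graphs) `(G₁, G₂)` with `n₂ ≥ m₁` (equivalently `n₁ ≥ m₂`): ALL cone-versus-even-cycle
PARITY pairs `(K_{1,n}, C_n ⊔ pt)`, the RIGID family `(K_{1,4m−2} ⊔ K₂, m·C₄)` of the g31/g32 census (both evaluation doors and every
face pivot fail there; hybrid-certified numerically only), `(K_{1,5}, C₄ ⊔ K₂)`, …; and every higher-dimensional pair whose faces of
size `≥ 2` are outnumbered by the other side's vertices.

PROOF (the one-centre degeneration of …StarOneCentre + the block specialisation of …StarVertexRichSplit). Weights: `d̄` = independent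
variables; EDGE weights `c̄ = ḡ + d̄` = independent variables on `R₀v × K₀v` and ZERO elsewhere (`ḡ = −d̄` off the block: no
two-vertex stars there). After the column permutation `κ` of the split, the one-centre matrix is BLOCK-TRIANGULAR
(`Matrix.BlockTriangular.det`) for the class order (row faces `≥ 2` ↔ `K₁`) < (`R₀` ↔ `K₀`) < (`R₁` ↔ column faces `≥ 2`) < (`∅` ↔ `∅`),
with diagonal blocks `[∏_{b ∈ A} (−d̄ b e)]`, `[c̄ b e]`, `[∏_{e ∈ S} d̄ b e]`, `(1)` (§1–§2). Each block determinant is a nonzero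
polynomial: evaluated at a suitable `0/1` point it becomes the INCLUSION MATRIX of an injective family of sets
(`ProductStateSums.det_inclusionMatrix`, determinant `1`) or the identity (§2). A nonzero polynomial over `ℂ` has a non-root
(`MvPolynomial.funext`), and the one-centre principle `starDet_ne_zero_of_oneTop` turns the nonsingular one-centre matrix into
weights (§3).
-/

set_option linter.dupNamespace false

namespace Summit.ValiantsHypothesis.ValiantsHypothesis.Theorems.BarrierLever.AnchoredPeeling

open Finset MvPolynomial
open Summit.ValiantsHypothesis.ValiantsHypothesis.Theorems.BarrierLever.ProductStateSums (det_inclusionMatrix)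

noncomputable section

namespace StarDoor

namespace VRSplit

variable {h r : ℕ} {u w : Fin r → Finset (Fin h)} (S : VRSplit u w)

/-! ## 1. The permuted symbolic one-centre matrix and its block structure -/

/-- The symbolic one-centre matrix of the block specialisation, columns permuted by `κ`. -/
def N : Matrix (Fin r) (Fin r) (MvPolynomial (VRVars h) ℂ) :=
  Matrix.of fun i j => oneTop (gSym S.R0v S.K0v) dSym (u i) (w (S.κ j))

/-- Entries of the permuted symbolic one-centre matrix. -/
theorem N_apply (i j : Fin r) : S.N i j = oneTop (gSym S.R0v S.K0v) dSym (u i) (w (S.κ j)) := rfl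

/-- Vertex row against vertex column: the edge variable (or zero). -/
theorem oneTop_vv {i j' : Fin r} (hi : (u i).card = 1) (hj' : (w j').card = 1) :
    oneTop (gSym S.R0v S.K0v) dSym (u i) (w j') = ∑ b ∈ u i, ∑ e ∈ w j', cSym S.R0v S.K0v b e := by
  rw [oneTop_card_one_card_one _ _ hi hj']
  simp_rw [dSym_add_gSym]

/-- **Block triangularity** for the class order `0 < 1 < 2 < 3`. -/
theorem blockTriangular_N (hu : Function.Injective u) (hw : Function.Injective w) : S.N.BlockTriangular S.rt := by
  intro i j hlt
  rw [N_apply]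
  have hκj := S.ct_κ j
  have hi3 := S.rt_le_three i
  by_cases h1 : S.rt i = 1
  · -- row in R₀; column class 0 = K₁: its vertex is outside K₀v
    have hi : i ∈ S.R0 := (S.rt_eq_one_iff i).mp h1
    have hjK1 : S.κ j ∈ S.K1 := (S.ct_eq_zero_iff _).mp (by omega)
    have hjc : (w (S.κ j)).card = 1 := S.card_K1 _ hjK1
    have hjK0 : S.κ j ∉ S.K0 := fun h0 => S.disj_K _ h0 hjK1
    rw [S.oneTop_vv (S.card_R0 i hi) hjc]
    refine Finset.sum_eq_zero fun b _ => Finset.sum_eq_zero fun e he => ?_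
    exact cSym_eq_zero_right b (S.not_mem_K0v hw hjc hjK0 he)
  by_cases h2 : S.rt i = 2
  · -- row in R₁ (vertex outside R₀v); column class 0 or 1, a vertex column
    have hi : i ∈ S.R1 := (S.rt_eq_two_iff i).mp h2
    have hic : (u i).card = 1 := S.card_R1 i hi
    have hiR0 : i ∉ S.R0 := fun h0 => S.disj_R i h0 hi
    have hjc : (w (S.κ j)).card = 1 := by
      by_cases hj0 : S.rt j = 0
      · exact S.card_K1 _ ((S.ct_eq_zero_iff _).mp (hκj.trans hj0))
      · exact S.card_K0 _ ((S.ct_eq_one_iff _).mp (hκj.trans (by omega)))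
    rw [S.oneTop_vv hic hjc]
    refine Finset.sum_eq_zero fun b hb => Finset.sum_eq_zero fun e _ => ?_
    exact cSym_eq_zero_left (S.not_mem_R0v hu hic hiR0 hb) e
  by_cases h3 : S.rt i = 3
  · -- the empty row, against a nonempty column
    have hi : u i = ∅ := Finset.card_eq_zero.mp ((S.rt_eq_three_iff i).mp h3)
    have hjne : w (S.κ j) ≠ ∅ := fun h0 => by
      have := (S.ct_eq_three_iff _).mpr (Finset.card_eq_zero.mpr h0); omega
    rw [hi, oneTop_empty_left, if_neg hjne]
  · omega

/-! ## 2. The diagonal blocks are nonsingular -/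

/-- A determinant of polynomials is nonzero if some evaluation of it is. -/
theorem det_ne_zero_of_eval {ι σ : Type*} [Fintype ι] [DecidableEq ι] (B : Matrix ι ι (MvPolynomial σ ℂ)) (v : σ → ℂ)
    (hB : (B.map (MvPolynomial.eval v)).det ≠ 0) : B.det ≠ 0 := by
  intro hB0
  apply hB
  rw [← RingHom.mapMatrix_apply, ← RingHom.map_det, hB0, map_zero]

/-- **Class 0:** row faces of size `≥ 2` against the vertex columns `K₁`; entries `∏_{b ∈ A} (−d̄ b e)`; at the point
`d̄ b e = −[b ∈ u (partner of e)]` the block is the inclusion matrix of the row faces. -/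
theorem det_block_zero_ne_zero (hu : Function.Injective u) (hw : Function.Injective w) :
    (S.N.toSquareBlock S.rt 0).det ≠ 0 := by
  classical
  let v : VRVars h → ℂ := fun x => match x with
    | Sum.inl _ => 0
    | Sum.inr (b, e) => -(if ∃ j, w (S.κ j) = {e} ∧ b ∈ u j then 1 else 0)
  refine det_ne_zero_of_eval _ v ?_
  have hent : (S.N.toSquareBlock S.rt 0).map (MvPolynomial.eval v) =
      Matrix.of fun p q : {a // S.rt a = 0} => if u p.1 ⊆ u q.1 then (1 : ℂ) else 0 := by
    ext ⟨p, hp⟩ ⟨q, hq⟩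
    have hpB : 2 ≤ (u p).card := (S.rt_eq_zero_iff p).mp hp
    have hqK1 : S.κ q ∈ S.K1 := (S.ct_eq_zero_iff _).mp ((S.ct_κ q).trans hq)
    have hqc : (w (S.κ q)).card = 1 := S.card_K1 _ hqK1
    have hqK0 : S.κ q ∉ S.K0 := fun h0 => S.disj_K _ h0 hqK1
    obtain ⟨e, he⟩ := Finset.card_eq_one.mp hqc
    have he' : e ∉ S.K0v := S.not_mem_K0v hw hqc hqK0 (by rw [he]; exact Finset.mem_singleton_self e)
    simp only [Matrix.map_apply, Matrix.toSquareBlock_def, N_apply, Matrix.of_apply]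
    rw [oneTop_card_one_right _ _ hpB hqc, he, Finset.prod_singleton, map_prod]
    have hge : ∀ b, MvPolynomial.eval v (gSym S.R0v S.K0v b e) = if b ∈ u q then 1 else 0 := by
      intro b
      rw [gSym, cSym_eq_zero_right b he', zero_sub, map_neg, dSym, MvPolynomial.eval_X]
      have hex : (∃ j, w (S.κ j) = {e} ∧ b ∈ u j) ↔ b ∈ u q := by
        constructor
        · rintro ⟨j, hj, hbj⟩
          have : S.κ j = S.κ q := hw (hj.trans he.symm)
          rw [S.κ.injective this] at hbj; exact hbj
        · intro hb; exact ⟨q, he, hb⟩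
      simp only [v, hex, neg_neg]
    simp_rw [hge]
    rw [Finset.prod_boole]
    by_cases hs : u p ⊆ u q
    · rw [if_pos hs, if_pos (show ∀ b ∈ u p, b ∈ u q from fun b hb => hs hb)]
    · rw [if_neg hs, if_neg (show ¬ ∀ b ∈ u p, b ∈ u q from fun h' => hs fun b hb => h' b hb)]
  rw [hent, det_inclusionMatrix (fun a : {a // S.rt a = 0} => u a.1) (fun a b hab => Subtype.ext (hu hab))]
  exact one_ne_zero

/-- **Class 1:** `R₀ × K₀`, the edge variables `c̄ b e`; at the point `c̄ b e = [b, e partners]` the block is the identity. -/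
theorem det_block_one_ne_zero (hu : Function.Injective u) (hw : Function.Injective w) :
    (S.N.toSquareBlock S.rt 1).det ≠ 0 := by
  classical
  let v : VRVars h → ℂ := fun x => match x with
    | Sum.inl (b, e) => if ∃ i, u i = {b} ∧ w (S.κ i) = {e} then 1 else 0
    | Sum.inr _ => 0
  refine det_ne_zero_of_eval _ v ?_
  have hent : (S.N.toSquareBlock S.rt 1).map (MvPolynomial.eval v) = 1 := by
    ext ⟨p, hp⟩ ⟨q, hq⟩
    have hpR0 : p ∈ S.R0 := (S.rt_eq_one_iff p).mp hp
    have hpc : (u p).card = 1 := S.card_R0 p hpR0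
    have hqK0 : S.κ q ∈ S.K0 := (S.ct_eq_one_iff _).mp ((S.ct_κ q).trans hq)
    have hqc : (w (S.κ q)).card = 1 := S.card_K0 _ hqK0
    obtain ⟨b, hb⟩ := Finset.card_eq_one.mp hpc
    obtain ⟨e, he⟩ := Finset.card_eq_one.mp hqc
    have hbv : b ∈ S.R0v := S.mem_R0v hpR0 (by rw [hb]; exact Finset.mem_singleton_self b)
    have hev : e ∈ S.K0v := S.mem_K0v hqK0 (by rw [he]; exact Finset.mem_singleton_self e)
    simp only [Matrix.map_apply, Matrix.toSquareBlock_def, N_apply, Matrix.of_apply]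
    rw [S.oneTop_vv hpc hqc, hb, he, Finset.sum_singleton, Finset.sum_singleton, cSym_of_mem hbv hev,
      MvPolynomial.eval_X]
    have hex : (∃ i, u i = {b} ∧ w (S.κ i) = {e}) ↔ p = q := by
      constructor
      · rintro ⟨i, hi, hi'⟩
        have h1 : i = p := hu (hi.trans hb.symm)
        have h2 : S.κ i = S.κ q := hw (hi'.trans he.symm)
        exact h1.symm.trans (S.κ.injective h2)
      · rintro rfl; exact ⟨p, hb, he⟩
    simp only [v, hex, Matrix.one_apply, Subtype.mk.injEq]
  rw [hent, Matrix.det_one]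
  exact one_ne_zero

/-- **Class 2:** `R₁` against the column faces of size `≥ 2`; entries `∏_{e ∈ S} d̄ b e`; at the point `d̄ b e = [e ∈ partner of b]`
the block is the transposed inclusion matrix of the column faces. -/
theorem det_block_two_ne_zero (hu : Function.Injective u) (hw : Function.Injective w) :
    (S.N.toSquareBlock S.rt 2).det ≠ 0 := by
  classical
  let v : VRVars h → ℂ := fun x => match x with
    | Sum.inl _ => 0
    | Sum.inr (b, e) => if ∃ i, u i = {b} ∧ e ∈ w (S.κ i) then 1 else 0
  refine det_ne_zero_of_eval _ v ?_
  have hent : (S.N.toSquareBlock S.rt 2).map (MvPolynomial.eval v) =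
      (Matrix.of fun p q : {a // S.rt a = 2} => if w (S.κ p.1) ⊆ w (S.κ q.1) then (1 : ℂ) else 0).transpose := by
    ext ⟨p, hp⟩ ⟨q, hq⟩
    have hpR1 : p ∈ S.R1 := (S.rt_eq_two_iff p).mp hp
    have hpc : (u p).card = 1 := S.card_R1 p hpR1
    have hqB : 2 ≤ (w (S.κ q)).card := (S.ct_eq_two_iff _).mp ((S.ct_κ q).trans hq)
    obtain ⟨b, hb⟩ := Finset.card_eq_one.mp hpc
    simp only [Matrix.map_apply, Matrix.toSquareBlock_def, N_apply, Matrix.of_apply, Matrix.transpose_apply]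
    rw [oneTop_card_one_left _ _ hpc hqB, hb, Finset.prod_singleton, map_prod]
    have hde : ∀ e, MvPolynomial.eval v (dSym b e) = if e ∈ w (S.κ p) then 1 else 0 := by
      intro e
      rw [dSym, MvPolynomial.eval_X]
      have hex : (∃ i, u i = {b} ∧ e ∈ w (S.κ i)) ↔ e ∈ w (S.κ p) := by
        constructor
        · rintro ⟨i, hi, hei⟩
          rw [hu (hi.trans hb.symm)] at hei; exact hei
        · intro he; exact ⟨p, hb, he⟩
      simp only [v, hex]
    simp_rw [hde]
    rw [Finset.prod_boole]
    by_cases hs : w (S.κ q) ⊆ w (S.κ p)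
    · rw [if_pos hs, if_pos (show ∀ e ∈ w (S.κ q), e ∈ w (S.κ p) from fun e he => hs he)]
    · rw [if_neg hs, if_neg (show ¬ ∀ e ∈ w (S.κ q), e ∈ w (S.κ p) from fun h' => hs fun e he => h' e he)]
  rw [hent, Matrix.det_transpose,
    det_inclusionMatrix (fun a : {a // S.rt a = 2} => w (S.κ a.1)) (fun a b hab => Subtype.ext (S.κ.injective (hw hab)))]
  exact one_ne_zero

/-- **Class 3:** the empty row against the empty column, the `1 × 1` block `(1)`. -/
theorem det_block_three_ne_zero {i₁ : Fin r} (hi₁ : S.rt i₁ = 3) : (S.N.toSquareBlock S.rt 3).det ≠ 0 := by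
  haveI := S.subsingleton_fiber_three
  rw [Matrix.det_eq_elem_of_subsingleton _ ⟨i₁, hi₁⟩]
  simp only [Matrix.toSquareBlock_def, N_apply, Matrix.of_apply]
  have hi : u i₁ = ∅ := Finset.card_eq_zero.mp ((S.rt_eq_three_iff i₁).mp hi₁)
  have hj : w (S.κ i₁) = ∅ := Finset.card_eq_zero.mp ((S.ct_eq_three_iff _).mp ((S.ct_κ i₁).trans hi₁))
  rw [hi, hj, oneTop_empty_left, if_pos rfl]
  exact one_ne_zero

/-- **The permuted symbolic one-centre matrix is nonsingular.** -/
theorem det_N_ne_zero (hu : Function.Injective u) (hw : Function.Injective w) : S.N.det ≠ 0 := by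
  classical
  rw [Matrix.BlockTriangular.det (S.blockTriangular_N hu hw)]
  refine Finset.prod_ne_zero_iff.mpr fun k hk => ?_
  obtain ⟨i₁, _, hi₁⟩ := Finset.mem_image.mp hk
  have hk3 : k ≤ 3 := hi₁ ▸ S.rt_le_three i₁
  interval_cases k
  · exact S.det_block_zero_ne_zero hu hw
  · exact S.det_block_one_ne_zero hu hw
  · exact S.det_block_two_ne_zero hu hw
  · exact S.det_block_three_ne_zero hi₁

end VRSplit

/-! ## 3. The theorem -/

section Main

variable {h r : ℕ} (u w : Fin r → Finset (Fin h))

/-- **EVERY VERTEX-RICH LOWER PAIR IS STAR-GOOD.** If `u, w` are injective enumerations of lower families and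
`r ≤ #{i : |u i| = 1} + #{j : |w j| = 1} + 1`, some complex weights make the star-forest block nonsingular. -/
theorem starDet_ne_zero_of_vertexRich (hu : Function.Injective u) (hw : Function.Injective w)
    (hlu : IsLowerSet (Set.range u)) (hlw : IsLowerSet (Set.range w))
    (hrich : r ≤ (univ.filter fun i => (u i).card = 1).card + (univ.filter fun j => (w j).card = 1).card + 1) :
    ∃ g d : Fin h → Fin h → ℂ, (Matrix.of fun i j : Fin r => starEntry g d (u i) (w j)).det ≠ 0 := by
  classical
  rcases Nat.eq_zero_or_pos r with hr | hr
  · subst hr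
    refine ⟨fun _ _ => 0, fun _ _ => 0, ?_⟩
    rw [Matrix.det_eq_one_of_card_eq_zero (by simp)]
    exact one_ne_zero
  obtain ⟨S⟩ := exists_vrSplit u w hu hw hlu hlw hr hrich
  -- the unpermuted symbolic one-centre matrix is nonsingular
  let N₀ : Matrix (Fin r) (Fin r) (MvPolynomial (VRVars h) ℂ) :=
    Matrix.of fun i j => oneTop (gSym S.R0v S.K0v) dSym (u i) (w j)
  have hN : S.N = N₀.submatrix id S.κ := rfl
  have hN₀ : N₀.det ≠ 0 := by
    intro h0
    apply S.det_N_ne_zero hu hw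
    rw [hN, Matrix.det_permute', h0, mul_zero]
  -- a non-root of the symbolic determinant
  have hex : ∃ v : VRVars h → ℂ, MvPolynomial.eval v N₀.det ≠ 0 := by
    by_contra hall
    push Not at hall
    exact hN₀ (MvPolynomial.funext fun v => by rw [hall v, map_zero])
  obtain ⟨v, hv⟩ := hex
  refine starDet_ne_zero_of_oneTop u w (fun b e => MvPolynomial.eval v (gSym S.R0v S.K0v b e))
    (fun b e => MvPolynomial.eval v (dSym b e)) ?_
  have hmap : MvPolynomial.eval v N₀.det = (Matrix.of fun i j : Fin r =>
      oneTop (fun b e => MvPolynomial.eval v (gSym S.R0v S.K0v b e)) (fun b e => MvPolynomial.eval v (dSym b e))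
        (u i) (w j)).det := by
    rw [RingHom.map_det, RingHom.mapMatrix_apply]
    congr 1; ext i j; simp only [N₀, Matrix.map_apply, Matrix.of_apply]; rw [map_oneTop]
  rw [← hmap]
  exact hv

/-- **Vertex-rich injective lower pairs have `symbolicDet 2 ≠ 0`.** -/
theorem symbolicDet_two_ne_zero_of_vertexRich (hu : Function.Injective u) (hw : Function.Injective w)
    (hlu : IsLowerSet (Set.range u)) (hlw : IsLowerSet (Set.range w))
    (hrich : r ≤ (univ.filter fun i => (u i).card = 1).card + (univ.filter fun j => (w j).card = 1).card + 1) :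
    symbolicDet 2 h r u w ≠ 0 := by
  obtain ⟨g, d, hdet⟩ := starDet_ne_zero_of_vertexRich u w hu hw hlu hlw hrich
  exact symbolicDet_two_ne_zero_of_starDet g d u w hu hw hlu hlw hdet

/-- **… and are anchored hits at profile 2** (the item's conclusion, on this class). -/
theorem anchoredHit_two_of_vertexRich (hu : Function.Injective u) (hw : Function.Injective w)
    (hlu : IsLowerSet (Set.range u)) (hlw : IsLowerSet (Set.range w))
    (hrich : r ≤ (univ.filter fun i => (u i).card = 1).card + (univ.filter fun j => (w j).card = 1).card + 1) :
    AnchoredHit 2 h r u w :=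
  stub_genericPoint 2 h r u w (symbolicDet_two_ne_zero_of_vertexRich u w hu hw hlu hlw hrich)

end Main

end StarDoor

end

end Summit.ValiantsHypothesis.ValiantsHypothesis.Theorems.BarrierLever.AnchoredPeeling
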